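import Summits.QuantumFields.YangMills.Theorems.BalabanUVNodesN15KingModelFullPropagatorByPartsNE2
import Literature.MathematicalPhysics.QuantumFieldTheory.King1986.TorusCongr

/-!
# BalabanUVNodes ∕ N15 — THE KING-MODEL RUNG, PART Ω-a: THE BACKWARD COVARIANT PIECES `D⁻_μG = S_{−μ}∘(N∇_μA₀⁻¹)` OF KING's FULL `A = 0`
# PROPAGATOR AND THEIR TWO-GRID DEFECT, IN BLOCK-MAJORANT CURRENCY; ONE LEVEL UP READ AS A ONE-STEP BLOCKING (letters for the King inhabitant
# of dag-n15-w3's curved knit `CurvedSpecies.hasMaj_idef_curvDressed_kingTorus`)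

HONEST FRAMING.  Count-neutral helper (cell `pub-ymgap`, seat `pub-ymgap-dag-n15-e` g14; `--supports stmt-QuantumFields-20544 --as helper` = K3⁷
`SpineGivenEndpointR13SepCoPH`; FAN-OUT v1.1 §N15 s3 «KING-MODEL ∕ RIEMANN-KERNEL RUNG»).  TEMPLATE LITERATURE, `A = 0`: C. King's scalar U(1)-Higgs
MODEL on finite tori ([King1986] (2.13) p. 653, (4.1)–(4.5) p. 670), NOT Bałaban's covariant `G(U)`.  dag-n15-w3's end-to-end curved knit (their
`…N15CurvedDressedPairDefectKingTorus`, p595387) displays as its INDUCTIVE DATUM the block majorants AND η-defects of `G(U)` and of BOTH covariant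
derived pieces `D⁺_{R,μ}G(U)`, `D⁻_{R,μ}G(U)` on two grids.  Parts Σ-a∕Σ-d of this rung supply `G = A₀⁻¹` and the FORWARD piece `D⁺_μ = N∇_μA₀⁻¹`; THIS
FILE supplies the BACKWARD piece `D⁻_μA₀⁻¹ = S_{−μ}∘D⁺_μ` (`S_{−μ}λ = λ(· − e_μ)`): its plain majorants on both runs (a backward unit shift moves a point to
the same or an adjacent unit block: cost `e^{δ}`) and its TWO-GRID DEFECT through King's pairing `π`, by the Leibniz rule
`𝔇(S′_{−μ}D′, S_{−μ}D) = S′_{−μ}∘𝔇(D′, D) + 𝔇(S′_{−μ}, S_{−μ})∘D` and the one device of §3: the defect of the two backward shifts VANISHES on the lower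
face of a fibre (`π(x′ − e′_μ) = πx′ − e_μ`) and is the one-step backward difference inside it (`π(x′ − e′_μ) = πx′`) — so it costs the ONE-STEP HÖLDER
MODULUS of `N∇_μA₀⁻¹λ` ([B9] (3.43)₁ at `U ≡ 1`, this rung's `fullPropGradOp_holder_le` = [Ba4] (1.9)): `C·(L^K)^{−α}`.  §2 reads «one level up»
(`n = 1`, fine run `Tor (fine (L^1·L^K) M)`) as dag-n15-w3's ONE-STEP BLOCKING `blockOf L (fine (L^K) M) : Tor (fine L (fine (L^K) M)) → Tor (fine (L^K) M)`
through the canonical re-indexing `King1986.Torus.torCongr` (the two tori have coordinatewise equal periods `L·(L^K·M_μ) = L^1·L^K·M_μ`), and §1 proves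
that block majorants are insensitive to such a relabelling of a carrier.
* §1 `hasMaj_pullEquiv_comp` (target relabelled), `hasMaj_comp_pullEquivSymm` (source relabelled), `hasMaj_conjEquiv`.
* §2 `castT`, `castT_add_unitVec`, `castT_sub_unitVec`, `underPtN_castT` (`π ∘ cast = blockOf L (fine (L^K) M)`), `blockOf_castT` (the unit blocks agree).
* §3 `underPtN_sub_unitVec` (the face dichotomy one step back, = dag-n15-a `kingPr_sub_unitVec`), `addRight_symm_apply'`, `idef_shiftTBack_apply`,
  ★ `hasMaj_idefShiftTBack_comp`.
* §4 `hasMaj_shiftTBack_comp` (the backward shift costs `e^{ρ}`), `sub_unitVec_ne`.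
* §5 `kingDOp_eq_fgrad_comp`, `hasMaj_oneStepBwd_kingDOp`, `hasMaj_kingDOpBack_coarse`, `hasMaj_kingDOpBack_fine`, ★★ `hasMaj_idef_kingDOpBack` (the sequel Ω-b packages
  them with parts Σ-a∕Σ-d at ONE `(β, δ, m)` and inhabits the knit).
0 `sorry`, standard axioms; one plumbing `def` (`castT`).  HONEST SCOPE: `A = 0`, periodic b.c., odd `L ≥ 3`, cubes `2L^e`, `K ≥ 1`, `n ≥ 1`, `0 < m² ≤ m₀²`,
`0 ≤ γ < 1`, `0 < α < 1`; not Bałaban's `G(U)`; not a discharge of N15; NE2⁺ NOT PRINTED ∕ not proved; nothing continuum ∕ ℝ⁴ ∕ OS ∕ mass-gap ∕ Clay.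
Locators: [Balaban1985BackgroundPropagators] Thm 3.1 (3.42)–(3.43) pp. 397–398, (3.52) p. 400, (3.64) p. 403 (shapes: `D^±_U`, the stacked unknown);
[King1986] (2.13)–(2.17) p. 653, (2.20) p. 654, Thm 3.3 p. 655, (3.7)–(3.8) p. 656, p. 664 (pairing), Prop. 3.9 (3.73) p. 665; [Balaban1983RegularityDecay]
(1.9)–(1.10) p. 573; [Balaban1984PropagatorsII] (2.51) p. 232.
-/

noncomputable section

namespace Summit.QuantumFields.YangMills.BalabanUVNodes.N15KingModelRung.Curved

open Real Finset Matrix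
open Literature.MathematicalPhysics.QuantumFieldTheory.Balaban1983to89
open Literature.MathematicalPhysics.QuantumFieldTheory.Balaban1983to89.B11SectG (BlockNorm HasMaj)
open Literature.MathematicalPhysics.QuantumFieldTheory.Balaban1983to89.B11AxialTransport190 (abs_le_loc_ofBlocks loc_ofBlocks_le)
open Literature.MathematicalPhysics.QuantumFieldTheory.Balaban1983to89.T4EtaRateDefect (idef idef_apply idef_comp)
open Literature.MathematicalPhysics.QuantumFieldTheory.Balaban1983to89.T4EtaRateCoeffDefect (pull pull_apply)
open Literature.MathematicalPhysics.QuantumFieldTheory.Balaban1983to89.B5Prop11Plancherel (Tor fine unitVec)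
open Literature.MathematicalPhysics.QuantumFieldTheory.King1986 (aK)
open Literature.MathematicalPhysics.QuantumFieldTheory.King1986.Torus (fineOp blockOf tdistT tdistT_nonneg tdistT_symm tdistT_triangle tdistT_self
  tdistT_sub_unitVec_le torCongr val_torCongr torCongr_add torCongr_sub torCongr_unitVec val_blockOf)
open Summit.QuantumFields.YangMills.BalabanUVNodes.N15.VectorPiece (unitTorusGeoS kingPr kingPr_sub_unitVec tdistT_blockOf_sub_unitVec_le)
open Summit.QuantumFields.YangMills.BalabanUVNodes.N15.BackgroundLayer (fgrad)
open Summit.QuantumFields.YangMills.BalabanUVNodes.N15.SiteLayer (hasMaj_add_exp)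

variable {d : ℕ} (L : ℕ)

/-! ## §1 Block majorants are insensitive to a relabelling of the carrier -/

section Relabel

variable {g : B6.Geometry} {X₁ X' : Type} [Fintype X₁] [Fintype X'] {F₁ F₂ : Type} [AddCommGroup F₁] [Module ℝ F₁] [AddCommGroup F₂] [Module ℝ F₂]

/-- TARGET RELABELLED: if `T ≤ K` into the sharp block sizes of `blk`, then `(pull φ)∘T ≤ K` into those of `blk ∘ φ` (`K ≥ 0`; any map `φ`). [cite: Balaban1984PropagatorsII, (2.51) p.232 (block majorants: shape)] -/
theorem hasMaj_pullEquiv_comp {b₁ : BlockNorm g F₁} (blk : X₁ → g.Site) (φ : X' → X₁) {T : F₁ →ₗ[ℝ] (X₁ → ℝ)}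
    {Kf : g.Site → g.Site → ℝ} (hK : ∀ y y', 0 ≤ Kf y y') (h : HasMaj b₁ (BlockNorm.ofBlocks g blk) T Kf) :
    HasMaj b₁ (BlockNorm.ofBlocks g (blk ∘ φ)) (pull φ ∘ₗ T) Kf := by
  intro y' μ hμ y
  refine loc_ofBlocks_le (blk ∘ φ) _ (mul_nonneg (hK y y') (b₁.loc_nonneg y' μ)) fun x' hx' => ?_
  rw [LinearMap.comp_apply, pull_apply]
  exact (abs_le_loc_ofBlocks blk _ hx').trans (h y' μ hμ y)

/-- SOURCE RELABELLED: if `T ≤ K` out of the sharp block sizes of `blk`, then `T∘(pull φ⁻¹) ≤ K` out of those of `blk ∘ φ` (`K ≥ 0`; `φ` a bijection of the sites).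
[cite: Balaban1984PropagatorsII, (2.51) p.232 (block majorants: shape)] -/
theorem hasMaj_comp_pullEquivSymm {b₂ : BlockNorm g F₂} (blk : X₁ → g.Site) (φ : X' ≃ X₁) {T : (X₁ → ℝ) →ₗ[ℝ] F₂}
    {Kf : g.Site → g.Site → ℝ} (hK : ∀ y y', 0 ≤ Kf y y') (h : HasMaj (BlockNorm.ofBlocks g blk) b₂ T Kf) :
    HasMaj (BlockNorm.ofBlocks g (blk ∘ ⇑φ)) b₂ (T ∘ₗ pull ⇑φ.symm) Kf := by
  intro y' μ' hμ' y
  have hloc : (BlockNorm.ofBlocks g blk).IsLoc y' (pull ⇑φ.symm μ') := fun x₁ hx₁ => by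
    rw [pull_apply]
    exact hμ' (φ.symm x₁) (by rwa [Function.comp_apply, Equiv.apply_symm_apply])
  rw [LinearMap.comp_apply]
  refine (h y' _ hloc y).trans (mul_le_mul_of_nonneg_left ?_ (hK y y'))
  refine loc_ofBlocks_le blk _ ((BlockNorm.ofBlocks g (blk ∘ ⇑φ)).loc_nonneg y' μ') fun x₁ hx₁ => ?_
  rw [pull_apply]
  exact abs_le_loc_ofBlocks (blk ∘ ⇑φ) μ' (x' := φ.symm x₁) (by rw [Function.comp_apply, Equiv.apply_symm_apply]; exact hx₁)

/-- CONJUGATION: `T ≤ K` between the block sizes of `blk₁`, `blk₂` ⟹ `(pull φ)∘T∘(pull φ⁻¹) ≤ K` between those of `blk₁ ∘ φ`, `blk₂ ∘ φ`. [cite: Balaban1984PropagatorsII, (2.51) p.232 (shape); King1986, (2.20) p.654 (re-indexing)] -/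
theorem hasMaj_conjEquiv (blk₁ blk₂ : X₁ → g.Site) (φ : X' ≃ X₁) {T : (X₁ → ℝ) →ₗ[ℝ] (X₁ → ℝ)} {Kf : g.Site → g.Site → ℝ}
    (hK : ∀ y y', 0 ≤ Kf y y') (h : HasMaj (BlockNorm.ofBlocks g blk₁) (BlockNorm.ofBlocks g blk₂) T Kf) :
    HasMaj (BlockNorm.ofBlocks g (blk₁ ∘ ⇑φ)) (BlockNorm.ofBlocks g (blk₂ ∘ ⇑φ)) (pull ⇑φ ∘ₗ T ∘ₗ pull ⇑φ.symm) Kf :=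
  hasMaj_pullEquiv_comp blk₂ φ hK (hasMaj_comp_pullEquivSymm blk₁ φ hK h)

end Relabel

/-! ## §2 One level up as a one-step blocking: the canonical cast `Tor (fine L (fine (L^K) M)) ≃ Tor (fine (L^1·L^K) M)` -/

section Cast

variable [NeZero L] (K : ℕ) (M : Fin (d + 1) → ℕ) [∀ μ, NeZero (M μ)]

omit [NeZero L] [∀ μ, NeZero (M μ)] in
/-- The two spellings of the `(K+1)`-level torus have coordinatewise equal periods: `L·(L^K·M_μ) = L^1·L^K·M_μ`. [cite: King1986, (2.20) p.654 (re-indexing)] -/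
theorem fine_fineStep_eq : ∀ μ, fine L (fine (L ^ K) M) μ = fine (L ^ 1 * L ^ K) M μ := fun μ => by
  show L * (L ^ K * M μ) = L ^ 1 * L ^ K * M μ
  rw [pow_one, mul_assoc]

/-- THE CAST: dag-n15-w3's fine torus `Tor (fine L (fine (L^K) M))` (one blocking step above the η-run) IS the rung's `(K+1)`-level run
`Tor (fine (L^1·L^K) M)` (`King1986.Torus.torCongr`, coordinates preserved). [cite: King1986, (2.20) p.654 (re-indexing)] -/
def castT : Tor (fine L (fine (L ^ K) M)) ≃ Tor (fine (L ^ 1 * L ^ K) M) := torCongr (fine_fineStep_eq L K M)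

omit [NeZero L] [∀ μ, NeZero (M μ)] in
/-- The cast preserves coordinates. [cite: King1986, (2.20) p.654] -/
theorem val_castT (y' : Tor (fine L (fine (L ^ K) M))) (μ : Fin (d + 1)) : (castT L K M y' μ).val = (y' μ).val := val_torCongr _ y' μ

omit [NeZero L] [∀ μ, NeZero (M μ)] in
/-- The cast is a translation homomorphism: one step forward. [cite: King1986, (2.20) p.654] -/
theorem castT_add_unitVec (y' : Tor (fine L (fine (L ^ K) M))) (μ : Fin (d + 1)) :
    castT L K M (y' + unitVec (fine L (fine (L ^ K) M)) μ) = castT L K M y' + unitVec (fine (L ^ 1 * L ^ K) M) μ := by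
  rw [castT, torCongr_add, torCongr_unitVec]

omit [NeZero L] [∀ μ, NeZero (M μ)] in
/-- The cast is a translation homomorphism: one step back. [cite: King1986, (2.20) p.654] -/
theorem castT_sub_unitVec (y' : Tor (fine L (fine (L ^ K) M))) (μ : Fin (d + 1)) :
    castT L K M (y' - unitVec (fine L (fine (L ^ K) M)) μ) = castT L K M y' - unitVec (fine (L ^ 1 * L ^ K) M) μ := by
  rw [castT, torCongr_sub, torCongr_unitVec]

/-- ★ KING's PAIRING ONE LEVEL UP IS THE ONE-STEP BLOCK MAP: `π(cast y′) = blockOf L (fine (L^K) M) y′` (both read `⌊y′_μ∕L⌋`). [cite: King1986, p.664 (pairing «x′ ∈ B^n(x)», n = 1)] -/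
theorem underPtN_castT (y' : Tor (fine L (fine (L ^ K) M))) : underPtN L K 1 M (castT L K M y') = blockOf L (fine (L ^ K) M) y' := by
  funext μ
  apply ZMod.val_injective
  rw [val_underPtN, val_castT, pow_one, val_blockOf]

/-- Function-level form. [cite: King1986, p.664 (pairing)] -/
theorem underPtN_comp_castT : underPtN L K 1 M ∘ ⇑(castT L K M) = blockOf L (fine (L ^ K) M) := funext (underPtN_castT L K M)

/-- THE UNIT BLOCKS AGREE: the unit block of `cast y′` in the `(K+1)`-run is the unit block of the η-block of `y′`. [cite: King1986, p.664 (blocks)] -/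
theorem blockOf_castT (y' : Tor (fine L (fine (L ^ K) M))) :
    blockOf (L ^ 1 * L ^ K) M (castT L K M y') = blockOf (L ^ K) M (blockOf L (fine (L ^ K) M) y') := by
  rw [← underPtN_castT L K M y', blockOf_underPtN]

/-- Function-level form: dag-n15-w3's fine blocks `blk ∘ blockOf L ·` ARE the rung's fine unit blocks read through the cast. [cite: King1986, p.664 (blocks)] -/
theorem blockOf_comp_blockOf_eq : blockOf (L ^ K) M ∘ blockOf L (fine (L ^ K) M) = (blockOf (L ^ K) M ∘ underPtN L K 1 M) ∘ ⇑(castT L K M) :=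
  funext fun y' => by simp only [Function.comp_apply, underPtN_castT]

end Cast

/-! ## §3 The device: the defect of the two BACKWARD shifts through King's point pairing -/

section Device

variable [NeZero L] (K n : ℕ) (M : Fin (d + 1) → ℕ) [∀ μ, NeZero (M μ)]

/-- ONE STEP BACK UNDER THE PAIRING: `π(x′ − e′_κ)` is `π x′` (inside the fibre) or `π x′ − e_κ` (on the lower `κ`-face) — dag-n15-a's `kingPr_sub_unitVec` read for
`underPtN = kingPr`. [cite: King1986, p.664 (pairing convention)] -/
theorem underPtN_sub_unitVec (x' : Tor (fine (L ^ n * L ^ K) M)) (κ : Fin (d + 1)) :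
    underPtN L K n M (x' - unitVec (fine (L ^ n * L ^ K) M) κ) = underPtN L K n M x' ∨
      underPtN L K n M (x' - unitVec (fine (L ^ n * L ^ K) M) κ) = underPtN L K n M x' - unitVec (fine (L ^ K) M) κ := by
  rw [underPtN_eq_kingPr]
  exact kingPr_sub_unitVec M L K n x' κ

omit [NeZero L] [∀ μ, NeZero (M μ)] in
/-- The inverse of the translation by `v` is the translation by `−v`: `(· + v)⁻¹ x = x − v`. [folklore] -/
theorem addRight_symm_apply' {P : Fin (d + 1) → ℕ} (v x : Tor P) : (Equiv.addRight v).symm x = x - v :=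
  (Equiv.symm_apply_eq _).mpr (by simp only [Equiv.coe_addRight, sub_add_cancel])

omit [NeZero L] [∀ μ, NeZero (M μ)] in
/-- The defect of the two backward shifts, pointwise: `𝔇(S′_{−κ}, S_{−κ})g(x′) = g(π(x′ − e′_κ)) − g(πx′ − e_κ)`. [folklore] -/
theorem idef_shiftTBack_apply (κ : Fin (d + 1)) (g : Tor (fine (L ^ K) M) → ℝ) (x' : Tor (fine (L ^ n * L ^ K) M)) :
    idef (pull (underPtN L K n M)) (pull (underPtN L K n M)) (pull ⇑(Equiv.addRight (unitVec (fine (L ^ n * L ^ K) M) κ)).symm)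
      (pull ⇑(Equiv.addRight (unitVec (fine (L ^ K) M) κ)).symm) g x' =
      g (underPtN L K n M (x' - unitVec (fine (L ^ n * L ^ K) M) κ)) - g (underPtN L K n M x' - unitVec (fine (L ^ K) M) κ) := by
  rw [idef_apply, Pi.sub_apply, pull_apply, pull_apply, pull_apply, pull_apply, addRight_symm_apply', addRight_symm_apply']

/-- ★ **THE DEFECT OF THE TWO BACKWARD SHIFTS IS MAJORISED BY THE ONE-STEP BACKWARD DIFFERENCE**: through King's point pairing, `𝔇(S′_{−κ}, S_{−κ})∘T` has every block
majorant `K ≥ 0` that `(S_{−κ} − 1)∘T` has — the defect VANISHES on the lower `κ`-face of the fibre and is minus the one-step backward difference inside it.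
[cite: King1986, p.664 (pairing convention: the mechanism); Balaban1985BackgroundPropagators, (3.64) p.403 (the backward piece `D⁻_U` of the stacked unknown: shape)] -/
theorem hasMaj_idefShiftTBack_comp {Msz : ℝ} {F₁ : Type} [AddCommGroup F₁] [Module ℝ F₁] {b₁ : BlockNorm (unitTorusGeoS L K M Msz) F₁}
    {T : F₁ →ₗ[ℝ] (Tor (fine (L ^ K) M) → ℝ)} {Kf : Tor M → Tor M → ℝ} (hK : ∀ y y', 0 ≤ Kf y y') (κ : Fin (d + 1))
    (h : HasMaj b₁ (BlockNorm.ofBlocks (unitTorusGeoS L K M Msz) (blockOf (L ^ K) M))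
      ((pull ⇑(Equiv.addRight (unitVec (fine (L ^ K) M) κ)).symm - LinearMap.id) ∘ₗ T) Kf) :
    HasMaj b₁ (BlockNorm.ofBlocks (unitTorusGeoS L K M Msz) (blockOf (L ^ K) M ∘ underPtN L K n M))
      (idef (pull (underPtN L K n M)) (pull (underPtN L K n M)) (pull ⇑(Equiv.addRight (unitVec (fine (L ^ n * L ^ K) M) κ)).symm)
        (pull ⇑(Equiv.addRight (unitVec (fine (L ^ K) M) κ)).symm) ∘ₗ T) Kf := by
  intro y' μ hμ y
  refine loc_ofBlocks_le (g := unitTorusGeoS L K M Msz) _ _ (mul_nonneg (hK y y') (b₁.loc_nonneg y' μ)) fun x' hx' => ?_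
  rw [LinearMap.comp_apply, idef_shiftTBack_apply]
  rcases underPtN_sub_unitVec L K n M x' κ with hc | hc
  · -- inside the fibre: minus the one-step backward difference at the paired point
    rw [hc]
    have hval : T μ (underPtN L K n M x') - T μ (underPtN L K n M x' - unitVec (fine (L ^ K) M) κ) =
        -((((pull ⇑(Equiv.addRight (unitVec (fine (L ^ K) M) κ)).symm - LinearMap.id) ∘ₗ T : F₁ →ₗ[ℝ] (Tor (fine (L ^ K) M) → ℝ)) μ)
          (underPtN L K n M x')) := by
      rw [LinearMap.comp_apply, LinearMap.sub_apply, Pi.sub_apply, pull_apply, addRight_symm_apply', LinearMap.id_apply, neg_sub]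
    rw [hval, abs_neg]
    have hx : blockOf (L ^ K) M (underPtN L K n M x') = y := hx'
    exact (abs_le_loc_ofBlocks (g := unitTorusGeoS L K M Msz) (blockOf (L ^ K) M) _ hx).trans (h y' μ hμ y)
  · -- on the lower face: the two shifts are paired, the defect vanishes
    rw [hc, sub_self, abs_zero]
    exact mul_nonneg (hK y y') (b₁.loc_nonneg y' μ)

end Device

/-! ## §4 The backward shift's cost and a stepped point -/

section Shift

variable [NeZero L] (K N : ℕ) [NeZero N] (M : Fin (d + 1) → ℕ) [∀ μ, NeZero (M μ)] (Msz : ℝ)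

omit [NeZero L] in
/-- Composing with the BACKWARD shift costs `e^{ρ}`: `S_{−κ}∘T ≤ B·e^{ρ}·e^{−ρ|y−y′|_T}` if `T ≤ B·e^{−ρ|y−y′|_T}` (the stepped-back point lies in the same or an adjacent unit
block). [cite: King1986, p.664 (unit blocks)] -/
theorem hasMaj_shiftTBack_comp {F₁ : Type} [AddCommGroup F₁] [Module ℝ F₁] {b₁ : BlockNorm (unitTorusGeoS L K M Msz) F₁} {T : F₁ →ₗ[ℝ] (Tor (fine N M) → ℝ)}
    {B ρ : ℝ} (hB : 0 ≤ B) (hρ : 0 ≤ ρ) (κ : Fin (d + 1))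
    (h : HasMaj b₁ (BlockNorm.ofBlocks (unitTorusGeoS L K M Msz) (blockOf N M)) T (fun y y' => B * Real.exp (-(ρ * tdistT M y y')))) :
    HasMaj b₁ (BlockNorm.ofBlocks (unitTorusGeoS L K M Msz) (blockOf N M)) (pull ⇑(Equiv.addRight (unitVec (fine N M) κ)).symm ∘ₗ T)
      (fun y y' => B * Real.exp ρ * Real.exp (-(ρ * tdistT M y y'))) := by
  intro y' μ hμ y
  refine loc_ofBlocks_le (g := unitTorusGeoS L K M Msz) _ _ (mul_nonneg (by positivity) (b₁.loc_nonneg y' μ)) fun x hx => ?_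
  rw [LinearMap.comp_apply, pull_apply, addRight_symm_apply']
  -- the stepped-back point lies in the block `y₁ := B(x − e_κ)`, at distance `≤ 1` from `y = B(x)`
  set y₁ := blockOf N M (x - unitVec (fine N M) κ) with hy₁
  have h1 : |T μ (x - unitVec (fine N M) κ)| ≤ B * Real.exp (-(ρ * tdistT M y₁ y')) * b₁.loc y' μ :=
    (abs_le_loc_ofBlocks (g := unitTorusGeoS L K M Msz) (blockOf N M) _ rfl).trans (h y' μ hμ y₁)
  have hd : tdistT M y y' ≤ tdistT M y₁ y' + 1 := by
    have h2 : tdistT M y y₁ ≤ 1 := by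
      rw [← hx, hy₁, tdistT_symm]
      exact tdistT_blockOf_sub_unitVec_le N M x κ
    linarith [tdistT_triangle M y y₁ y']
  refine h1.trans (mul_le_mul_of_nonneg_right ?_ (b₁.loc_nonneg y' μ))
  show B * Real.exp (-(ρ * tdistT M y₁ y')) ≤ B * Real.exp ρ * Real.exp (-(ρ * tdistT M y y'))
  rw [mul_assoc, ← Real.exp_add]
  exact mul_le_mul_of_nonneg_left (Real.exp_le_exp.mpr (by nlinarith)) hB

omit [NeZero L] [∀ μ, NeZero (M μ)] in
/-- A unit step back moves the point (the fine periods are `≥ 2`). [folklore] -/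
theorem sub_unitVec_ne (hN : ∀ μ, 2 ≤ fine N M μ) (x : Tor (fine N M)) (κ : Fin (d + 1)) : x - unitVec (fine N M) κ ≠ x := by
  intro h
  have h' : x - unitVec (fine N M) κ + unitVec (fine N M) κ = x + unitVec (fine N M) κ := by rw [h]
  rw [sub_add_cancel] at h'
  exact add_unitVec_ne M N hN x κ h'.symm

end Shift

/-! ## §5 The letters: the backward covariant piece of King's full propagator, plain and two-grid -/

section Letters

/-- DICTIONARY: the rung's forward piece IS the device's `fgrad` after `G` — `D_μ = N∇_μ∘A₀⁻¹ = fgrad N (· + e_μ) ∘ A₀⁻¹`. [cite: Balaban1985BackgroundPropagators, (3.42) p.397 (second entry, shape)] -/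
theorem kingDOp_eq_fgrad_comp (a msq : ℝ) (K N : ℕ) [NeZero N] (M : Fin (d + 1) → ℕ) [∀ μ, NeZero (M μ)] (μ : Fin (d + 1)) :
    kingDOp L a msq K N M μ = fgrad (N : ℝ) (Equiv.addRight (unitVec (fine N M) μ)) ∘ₗ kingGOp L a msq K N M := rfl

variable [NeZero L]

/-- **THE ONE-STEP BACKWARD DIFFERENCE OF `D_μ = N∇_μA₀⁻¹` ON THE COARSE RUN**: for odd `L ≥ 3`, `a > 0`, `0 ≤ m₀²`, `0 < α < 1` there are `C, δ > 0` with
`(S_{−κ} − 1)∘D_μ ≤ C·(L^K)^{−α}·e^{−δ|y−y′|_T}` between the sharp unit-block sizes — [B9] (3.43)₁ at `U ≡ 1` (this rung's `fullPropGradOp_holder_le`: the Hölder modulus of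
`N∇_μA₀⁻¹λ`, = [Ba4] (1.9)) at one lattice step (`|x − x′| = 1 ≤ N = L^K`; the neighbour block costs `e^{δ}`). [cite: Balaban1985BackgroundPropagators, Thm 3.1 (3.43) p.398 (first half); Balaban1983RegularityDecay, Theorem (1.9) p.573; King1986, Thm 3.3 p.655, (3.8) p.656] -/
theorem hasMaj_oneStepBwd_kingDOp (hLodd : Odd L) (hL : 2 ≤ L) {a : ℝ} (ha : 0 < a) {m0sq : ℝ} (hm0 : 0 ≤ m0sq) {α : ℝ} (hα0 : 0 < α) (hα1 : α < 1) :
    ∃ C δ : ℝ, 0 < C ∧ 0 < δ ∧ ∀ (K : ℕ), 1 ≤ K → ∀ (e : ℕ) (M : Fin (d + 1) → ℕ) [∀ μ, NeZero (M μ)], (∀ μ, M μ = 2 * L ^ e) →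
      ∀ (msq : ℝ), 0 < msq → msq ≤ m0sq → ∀ (Msz : ℝ) (κ μ : Fin (d + 1)),
      HasMaj (BlockNorm.ofBlocks (unitTorusGeoS L K M Msz) (blockOf (L ^ K) M)) (BlockNorm.ofBlocks (unitTorusGeoS L K M Msz) (blockOf (L ^ K) M))
        ((pull ⇑(Equiv.addRight (unitVec (fine (L ^ K) M) κ)).symm - LinearMap.id) ∘ₗ kingDOp L a msq K (L ^ K) M μ)
        (fun y y' => C * ((L : ℝ) ^ K) ^ (-α) * Real.exp (-(δ * tdistT M y y'))) := by
  obtain ⟨C, δ, hC, hδ, H⟩ := fullPropGradOp_holder_le (d := d) L hLodd hL ha hm0 hα0 hα1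
  refine ⟨C * Real.exp δ, δ, by positivity, hδ, fun K hK e M _ hM msq hmsq hcap Msz κ μ => ?_⟩
  have hL1 : (1 : ℝ) ≤ (L : ℝ) := by exact_mod_cast (show 1 ≤ L by omega)
  have hθ : 0 ≤ ((L : ℝ) ^ K) ^ (-α) := Real.rpow_nonneg (by positivity) _
  have hfine : ∀ μ, 2 ≤ fine (L ^ K) M μ := fun μ => by
    show 2 ≤ L ^ K * M μ
    rw [hM μ]
    have h1 : 1 ≤ L ^ K := Nat.one_le_pow _ _ (by omega)
    have h2 : 1 ≤ L ^ e := Nat.one_le_pow _ _ (by omega)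
    nlinarith
  refine hasMaj_ofBlocks_of_cubeBound L _ _ _ (mul_nonneg (by positivity) hθ) fun lam F D hF x hD => ?_
  -- the block-distance hypothesis for the stepped-back point, one unit weaker
  have hD' : ∀ y, lam y ≠ 0 → (D : ℝ) - 1 ≤ tdistT M (blockOf (L ^ K) M (x - unitVec (fine (L ^ K) M) κ)) (blockOf (L ^ K) M y) := fun y hy => by
    have h1 := hD y hy
    have h2 := tdistT_blockOf_sub_unitVec_le (L ^ K) M x κ
    have h3 := tdistT_triangle M (blockOf (L ^ K) M x) (blockOf (L ^ K) M (x - unitVec (fine (L ^ K) M) κ)) (blockOf (L ^ K) M y)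
    rw [tdistT_symm] at h2
    linarith
  have hDx : ∀ y, lam y ≠ 0 → (D : ℝ) - 1 ≤ tdistT M (blockOf (L ^ K) M x) (blockOf (L ^ K) M y) := fun y hy => by linarith [hD y hy]
  have key := H K hK (L ^ K) rfl e M hM msq hmsq hcap μ lam F ((D : ℝ) - 1) hF x (x - unitVec (fine (L ^ K) M) κ) hDx hD'
  -- the distance of the two points is exactly one lattice step
  set t : ℝ := tdistT (fine (L ^ K) M) x (x - unitVec (fine (L ^ K) M) κ) with ht
  have ht1 : t = 1 := le_antisymm (tdistT_sub_unitVec_le (fine (L ^ K) M) x κ)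
    (one_le_tdistT_of_ne (fine (L ^ K) M) (sub_unitVec_ne (L ^ K) M hfine x κ).symm)
  have hcast : ((L ^ K : ℕ) : ℝ) = (L : ℝ) ^ K := by push_cast; ring
  have hfac : (t / ((L ^ K : ℕ) : ℝ)) ^ (-α) = (((L : ℝ) ^ K) ^ (-α))⁻¹ := by
    rw [ht1, hcast, one_div, Real.inv_rpow (by positivity)]
  rw [hfac] at key
  have hθpos : 0 < ((L : ℝ) ^ K) ^ (-α) := Real.rpow_pos_of_pos (by positivity) _
  rw [LinearMap.comp_apply, LinearMap.sub_apply, Pi.sub_apply, pull_apply, addRight_symm_apply', LinearMap.id_apply, kingDOp_apply, kingDOp_apply]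
  rw [inv_mul_le_iff₀ hθpos] at key
  refine key.trans (le_of_eq ?_)
  rw [show Real.exp (-(δ * ((D : ℝ) - 1))) = Real.exp δ * Real.exp (-(δ * D)) by rw [← Real.exp_add]; ring_nf]
  ring

/-- **PLAIN LETTER `D⁻_μ = S_{−μ}∘D_μ`, COARSE RUN**: part Σ-d `hasMaj_kingDOp_coarse` ((3.42)₁ at `U ≡ 1`, part Ψ-e) shifted back one step (§4, cost `e^{δ}`); any shift direction `κ`.
[cite: Balaban1985BackgroundPropagators, Thm 3.1 (3.42) p.397 (second entry), (3.64) p.403 (`D⁻_U`: shape); Balaban1983RegularityDecay, Theorem (1.10) p.573] -/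
theorem hasMaj_kingDOpBack_coarse (hLodd : Odd L) (hL : 2 ≤ L) {a : ℝ} (ha : 0 < a) {m0sq : ℝ} (hm0 : 0 ≤ m0sq) :
    ∃ β δ : ℝ, 0 < β ∧ 0 < δ ∧ ∀ (K : ℕ), 1 ≤ K → ∀ (e : ℕ) (M : Fin (d + 1) → ℕ) [∀ μ, NeZero (M μ)], (∀ μ, M μ = 2 * L ^ e) →
      ∀ (msq : ℝ), 0 < msq → msq ≤ m0sq → ∀ (Msz : ℝ) (κ μ : Fin (d + 1)),
      HasMaj (BlockNorm.ofBlocks (unitTorusGeoS L K M Msz) (blockOf (L ^ K) M)) (BlockNorm.ofBlocks (unitTorusGeoS L K M Msz) (blockOf (L ^ K) M))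
        (pull ⇑(Equiv.addRight (unitVec (fine (L ^ K) M) κ)).symm ∘ₗ kingDOp L a msq K (L ^ K) M μ)
        (fun y y' => β * Real.exp (-(δ * tdistT M y y'))) := by
  obtain ⟨C, δ, hC, hδ, H⟩ := hasMaj_kingDOp_coarse (d := d) L hLodd hL ha hm0
  refine ⟨C * Real.exp δ, δ, by positivity, hδ, fun K hK e M _ hM msq hmsq hcap Msz κ μ => ?_⟩
  exact hasMaj_shiftTBack_comp L K (L ^ K) M Msz hC.le hδ.le κ (H K hK e M hM msq hmsq hcap Msz μ)

/-- **PLAIN LETTER `D′⁻_μ = S′_{−μ}∘D′_μ`, FINE RUN** (blocks = the fine run's own unit blocks `blockOf ∘ π`): part Σ-a `hasMaj_kingDOp` shifted back one fine step.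
[cite: Balaban1985BackgroundPropagators, Thm 3.1 (3.42) p.397 (second entry), (3.64) p.403 (`D⁻_U`: shape); Balaban1983RegularityDecay, Theorem (1.10) p.573] -/
theorem hasMaj_kingDOpBack_fine (hLodd : Odd L) (hL : 2 ≤ L) {a : ℝ} (ha : 0 < a) {m0sq : ℝ} (hm0 : 0 ≤ m0sq) :
    ∃ β δ : ℝ, 0 < β ∧ 0 < δ ∧ ∀ (K : ℕ), 1 ≤ K → ∀ (n e : ℕ) (M : Fin (d + 1) → ℕ) [∀ μ, NeZero (M μ)], (∀ μ, M μ = 2 * L ^ e) →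
      ∀ (msq : ℝ), 0 < msq → msq ≤ m0sq → ∀ (Msz : ℝ) (κ μ : Fin (d + 1)),
      HasMaj (BlockNorm.ofBlocks (unitTorusGeoS L K M Msz) (blockOf (L ^ K) M ∘ underPtN L K n M))
        (BlockNorm.ofBlocks (unitTorusGeoS L K M Msz) (blockOf (L ^ K) M ∘ underPtN L K n M))
        (pull ⇑(Equiv.addRight (unitVec (fine (L ^ n * L ^ K) M) κ)).symm ∘ₗ kingDOp L a msq (K + n) (L ^ n * L ^ K) M μ)
        (fun y y' => β * Real.exp (-(δ * tdistT M y y'))) := by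
  obtain ⟨C, δ, hC, hδ, H⟩ := hasMaj_kingDOp (d := d) L hLodd hL ha hm0
  refine ⟨C * Real.exp δ, δ, by positivity, hδ, fun K hK n e M _ hM msq hmsq hcap Msz κ μ => ?_⟩
  have h := H K hK n e M hM msq hmsq hcap Msz μ
  rw [blockOf_comp_underPtN] at h ⊢
  exact hasMaj_shiftTBack_comp L K (L ^ n * L ^ K) M Msz hC.le hδ.le κ h

/-- ★★ **THE TWO-GRID DEFECT OF THE BACKWARD PIECE**: for odd `L ≥ 3`, `a > 0`, `0 ≤ m₀²`, `0 ≤ γ < 1`, `0 < α < 1` there are `C, δ > 0` such that for every `K ≥ 1`, `n ≥ 1`,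
cube `2L^e`, mass `0 < m² ≤ m₀²`, size datum and directions `κ, μ`:
`𝔇(S′_{−κ}∘D′_μ, S_{−κ}∘D_μ) ≤ C·((L^K)^{−γ∕2} + (L^K)^{−α})·e^{−δ|y−y′|_T}` from the sharp unit-block size of the coarse run to that of the fine run (`τλ = λ∘π`).  Content:
Leibniz `𝔇(S′D′, SD) = S′∘𝔇(D′, D) + 𝔇(S′, S)∘D`; the first term is part Σ-a's `𝔇(D′_μ, D_μ)` (King's (3.73), `|a| = 1`, summed over (2.17), uniform in `n`) shifted back (§4);
the second is §3's device paid by the one-step Hölder modulus of `D_μλ` (`hasMaj_oneStepBwd_kingDOp`). [cite: Balaban1985BackgroundPropagators, Thm 3.1 (3.42)–(3.43) pp.397–398, (3.64) p.403 (mechanism, shape); King1986, p.664 (pairing), Prop. 3.9 (3.73) p.665; Balaban1983RegularityDecay, (1.9)–(1.10) p.573] -/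
theorem hasMaj_idef_kingDOpBack (hLodd : Odd L) (hL : 2 ≤ L) {a : ℝ} (ha : 0 < a) {m0sq : ℝ} (hm0 : 0 ≤ m0sq) {γ : ℝ} (hγ0 : 0 ≤ γ) (hγ1 : γ < 1)
    {α : ℝ} (hα0 : 0 < α) (hα1 : α < 1) :
    ∃ C δ : ℝ, 0 < C ∧ 0 < δ ∧ ∀ (K : ℕ), 1 ≤ K → ∀ (n : ℕ), 1 ≤ n → ∀ (e : ℕ) (M : Fin (d + 1) → ℕ) [∀ μ, NeZero (M μ)], (∀ μ, M μ = 2 * L ^ e) →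
      ∀ (msq : ℝ), 0 < msq → msq ≤ m0sq → ∀ (Msz : ℝ) (κ μ : Fin (d + 1)),
      HasMaj (BlockNorm.ofBlocks (unitTorusGeoS L K M Msz) (blockOf (L ^ K) M))
        (BlockNorm.ofBlocks (unitTorusGeoS L K M Msz) (blockOf (L ^ K) M ∘ underPtN L K n M))
        (idef (pull (underPtN L K n M)) (pull (underPtN L K n M))
          (pull ⇑(Equiv.addRight (unitVec (fine (L ^ n * L ^ K) M) κ)).symm ∘ₗ kingDOp L a msq (K + n) (L ^ n * L ^ K) M μ)
          (pull ⇑(Equiv.addRight (unitVec (fine (L ^ K) M) κ)).symm ∘ₗ kingDOp L a msq K (L ^ K) M μ))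
        (fun y y' => C * (((L : ℝ) ^ K) ^ (-(γ / 2)) + ((L : ℝ) ^ K) ^ (-α)) * Real.exp (-(δ * tdistT M y y'))) := by
  obtain ⟨m₀, δ₀, hm₀, hδ₀, H0⟩ := hasMaj_idef_kingDOp (d := d) L hLodd hL ha hm0 hγ0 hγ1
  obtain ⟨C₁, δ₁, hC₁, hδ₁, H1⟩ := hasMaj_oneStepBwd_kingDOp (d := d) L hLodd hL ha hm0 hα0 hα1
  set δ : ℝ := min δ₀ δ₁ with hδdef
  have hδ : 0 < δ := lt_min hδ₀ hδ₁
  set C : ℝ := m₀ * Real.exp δ + C₁ with hCdef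
  have hC : 0 < C := by positivity
  refine ⟨C, δ, hC, hδ, fun K hK n hn e M _ hM msq hmsq hcap Msz κ μ => ?_⟩
  have hθ : 0 ≤ ((L : ℝ) ^ K) ^ (-(γ / 2)) := Real.rpow_nonneg (pow_nonneg (Nat.cast_nonneg _) _) _
  have hrα : 0 ≤ ((L : ℝ) ^ K) ^ (-α) := Real.rpow_nonneg (pow_nonneg (Nat.cast_nonneg _) _) _
  -- term A: `S′_{−κ} ∘ 𝔇(D′_μ, D_μ) ≤ m₀θe^{δ}·e^{−δd}` (the fine target blocks are the fine run's own unit blocks)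
  have hA0 := hasMaj_exp_weaken L (mul_nonneg hm₀.le hθ) le_rfl (min_le_left δ₀ δ₁) (H0 K hK n hn e M hM msq hmsq hcap Msz μ)
  rw [blockOf_comp_underPtN] at hA0
  have hA := hasMaj_shiftTBack_comp L K (L ^ n * L ^ K) M Msz (b₁ := BlockNorm.ofBlocks (unitTorusGeoS L K M Msz) (blockOf (L ^ K) M))
    (mul_nonneg hm₀.le hθ) hδ.le κ hA0
  rw [← blockOf_comp_underPtN] at hA
  -- term B: `𝔇(S′_{−κ}, S_{−κ}) ∘ D_μ ≤ C₁(L^K)^{−α}·e^{−δd}` (the device + the Hölder step)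
  have hB0 := hasMaj_exp_weaken L (mul_nonneg hC₁.le hrα) le_rfl (min_le_right δ₀ δ₁) (H1 K hK e M hM msq hmsq hcap Msz κ μ)
  have hB := hasMaj_idefShiftTBack_comp L K n M (b₁ := BlockNorm.ofBlocks (unitTorusGeoS L K M Msz) (blockOf (L ^ K) M))
    (fun _ _ => mul_nonneg (mul_nonneg hC₁.le hrα) (Real.exp_nonneg _)) κ hB0
  -- Leibniz
  have hsum := hasMaj_add_exp hA hB
  rw [← idef_comp (pull (underPtN L K n M)) (pull (underPtN L K n M)) (pull (underPtN L K n M))] at hsum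
  refine hsum.mono fun y y' => ?_
  show (m₀ * ((L : ℝ) ^ K) ^ (-(γ / 2)) * Real.exp δ + C₁ * ((L : ℝ) ^ K) ^ (-α)) * Real.exp (-(δ * tdistT M y y')) ≤
    C * (((L : ℝ) ^ K) ^ (-(γ / 2)) + ((L : ℝ) ^ K) ^ (-α)) * Real.exp (-(δ * tdistT M y y'))
  refine mul_le_mul_of_nonneg_right ?_ (Real.exp_nonneg _)
  rw [hCdef]
  have h1 : 0 ≤ m₀ * Real.exp δ * ((L : ℝ) ^ K) ^ (-α) := by positivity
  have h2 : 0 ≤ C₁ * ((L : ℝ) ^ K) ^ (-(γ / 2)) := by positivity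
  nlinarith

end Letters

end Summit.QuantumFields.YangMills.BalabanUVNodes.N15KingModelRung.Curved

end
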